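import Literature.Computability.AlgebraicComplexity.BurgisserRootCountGRH
import Literature.Computability.Complexity.PolyAdvicePH
import Literature.NumberTheory.LFunctions.EffectivePrimeIdealTheoremGRHProofs
import HarnessLib

/-!
# Bürgisser's collapse `P/poly = NP/poly = PH/poly` (pnp.S26, characteristic zero): assembly

Proof-only companion of `ValiantBooleanBridge.lean` for the named fact **pnp.S26**
`Literature.Computability.AlgebraicComplexity.burgisser_collapse_of_VP_eq_VNP_charZero k`
(Bürgisser, *Cook's versus Valiant's hypothesis*, TCS 235 (2000), Cor. 1.2(1), p. 74; book:
*Completeness and Reduction in Algebraic Complexity Theory*, Cor. 4.6(1)): over a field `k` of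
characteristic zero, `VP_k = VNP_k` and the generalised Riemann hypothesis (Dedekind form) give
`P/poly = NP/poly` **and** `NP/poly = PH/poly` (advice classes `polyAdvice`).

The printed proof (TCS p. 79): "`#P/poly ⊆ BP(VNP_k) = BP(VP_k) ⊆ FNC³/poly ⊆ FP/poly ⊆ #P/poly`,
thus we have equality everywhere. In particular, `P/poly = NP/poly`. It is well-known that
`P = NP` implies `P = PH` (cf. [12]). A similar argument shows that `P/poly = NP/poly` implies
`P/poly = PH/poly`." The tree has decomposed the first sentence along §5 and §4 of the paper
(`BurgisserBooleanParts.lean`, `BurgisserBooleanPartsA3Steps.lean`,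
`BurgisserBooleanPartsModPCircuits.lean`, `BurgisserBooleanPartsA3Assembly.lean`,
`BurgisserReductionModPrimes.lean`, `BurgisserRootCountGRH.lean`) down to two external named
facts, and has proved the last sentence
(`Literature.Computability.Complexity.polyAdvice_P_eq_polyAdvice_PH_of_polyAdvice_P_eq_polyAdvice_NP`,
`PolyAdvicePH.lean`). This file glues the two halves, so that the FULL statement of pnp.S26 in
characteristic zero (both conjuncts) is derived from each level of the decomposition:

| hypothesis (named fact) | source | theorem here |
|---|---|---|
| `NP ⊆ P/poly` (no fact) | TCS p. 79 | `polyAdvice_collapse_of_NP_subset_PPoly` |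
| (A3) `booleanPart_VP_cktSize k` | TCS Thm. 1.1(1), §5 (A3) | `burgisser_collapse_of_VP_eq_VNP_charZero_of_booleanPart_VP_cktSize` |
| Thm. 4.1 `reduction_mod_primes_of_GRH` | TCS Thm. 4.1 | `burgisser_collapse_of_VP_eq_VNP_charZero_of_reduction_mod_primes` |
| Thm. 4.5 `algebraicSolution_height_bound` + Cor. 4.8 `rootModPrimeCount_lower_bound_of_GRH` | TCS Thm. 4.5, Cor. 4.8 | `burgisser_collapse_of_VP_eq_VNP_charZero_of_heightBound_of_rootCount` |
| Thm. 4.5 + `effectivePrimeIdealTheorem_of_ERH` (Lagarias–Odlyzko; Serre Thm. 4) | TCS Thm. 4.5, eq. (3) p. 83 | `burgisser_collapse_of_VP_eq_VNP_charZero_of_heightBound_of_effectivePrimeIdealTheorem` |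

Hence `burgisser_collapse_of_VP_eq_VNP_charZero k` rests on exactly the two external theorems
`algebraicSolution_height_bound` (Krick–Pardo height bound, TCS Thm. 4.5) and
`Literature.NumberTheory.LFunctions.NumberField.effectivePrimeIdealTheorem_of_ERH` (the prime
ideal theorem under GRH with an absolute constant); everything else — (A2) by arithmetisation of
the verifier's circuits, the constant-free skeleton and the Nullstellensatz transfer, Chebyshev's
bound and the prime selection, the Boolean simulation of arithmetic modulo `p`, Remark 4.6, the
combination giving Thm. 4.1, Cor. 4.8 from the effective prime ideal theorem, Arora–Barak's
Thm. 6.18 `P/poly = P/poly-advice`, and the Karp–Lipton-style induction `NP ⊆ P/poly ⟹ PH ⊆ P/poly`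
— is proved in the tree. When the two facts are discharged,
`burgisser_collapse_of_VP_eq_VNP_charZero_holds k` is the last theorem of the table applied to
their `_holds` theorems.

**Update (2026-08-15, after the discharge of the effective prime ideal theorem).** The second
external theorem is now a theorem of the tree: `effectivePrimeIdealTheorem_of_ERH_holds`
(`EffectivePrimeIdealTheoremGRHProofs.lean`, from the uniform GRH bound
`|ψ_K(x) − x| ≤ c √x log x (log|d_K| + [K:ℚ] log x)` of `DedekindPsiGRHBound.lean`, Lagarias–Odlyzko
1977 Thm. 9.1, and the partial summation of `EffectivePrimeIdealTheoremGRHFromPsi.lean`). The last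
section of this file draws the consequence for Bürgisser's §5: (A3), `P/poly = NP/poly` and the full
pnp.S26 (char. 0) follow from Theorem 4.5 ALONE (`booleanPart_VP_cktSize_of_heightBound`,
`PPoly_eq_polyAdvice_NP_of_VP_eq_VNP_of_heightBound`,
`burgisser_collapse_of_VP_eq_VNP_charZero_of_heightBound`): the only unproved ingredient left under
`burgisser_collapse_of_VP_eq_VNP_charZero k` is `algebraicSolution_height_bound` (TCS Thm. 4.5:
Bézout's inequality, Lemmas 4.3–4.4, and Krick–Pardo [18, Prop. 27]; its two geometric inputs are
isolated in `BurgisserReductionModPrimesProofs.lean`).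

## References

* P. Bürgisser, *Cook's versus Valiant's hypothesis*, Theoret. Comput. Sci. 235 (2000) 71–88:
  Thm. 1.1(1) (p. 73), Cor. 1.2(1) (p. 74) and its proof (p. 79), Thm. 4.1 (p. 79), Thm. 4.5
  (p. 82), eq. (3) (p. 83), Cor. 4.8 (p. 84), §5 (A3) (pp. 85–86) (`Burgisser2000TCS`).
* P. Bürgisser, *Completeness and Reduction in Algebraic Complexity Theory*, Springer 2000,
  Thm. 4.5, Cor. 4.6(1) (book version; `Burgisser2000`).
* R. M. Karp, R. J. Lipton, *Turing machines that take advice*, Enseign. Math. 28 (1982), §1.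
* J.-P. Serre, *Quelques applications du théorème de densité de Chebotarev*, Publ. Math. IHÉS 54
  (1981), Thm. 4 (`Serre1981`).
-/

noncomputable section

open Literature.Computability.Complexity Literature.Computability.Complexity.Classes
  Literature.Computability.Complexity.Nondeterministic Literature.Computability.AlgebraicComplexity
  Literature.NumberTheory.LFunctions.NumberField

namespace Literature.Computability.AlgebraicComplexity

universe u

variable (k : Type u) [Field k]

/-- **Both advice collapses from `NP ⊆ P/poly`** (Bürgisser 2000 TCS, proof of Cor. 1.2, p. 79:
"In particular, `P/poly = NP/poly`. […] A similar argument shows that `P/poly = NP/poly` implies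
`P/poly = PH/poly`"): `P/poly-advice = NP/poly` by `P ⊆ NP`, monotonicity of advice and
`NP/poly ⊆ (P/poly)/poly = P/poly = P/poly-advice` (Arora–Barak Thm. 6.18,
`PPoly_eq_polyAdvice_P_holds`); then `NP/poly = PH/poly` by the tree's Karp–Lipton-style
induction over the levels of `PH` (`polyAdvice_P_eq_polyAdvice_PH_of_polyAdvice_P_eq_polyAdvice_NP`).
[cite: Burgisser2000TCS, proof of Cor. 1.2 p. 79] -/
theorem polyAdvice_collapse_of_NP_subset_PPoly (hNP : NP ⊆ PPoly) :
    polyAdvice P = polyAdvice NP ∧ polyAdvice NP = polyAdvice PH := by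
  have h1 : polyAdvice P = polyAdvice NP :=
    polyAdvice_P_eq_polyAdvice_NP_of_NP_subset_PPoly PPoly_eq_polyAdvice_P_holds hNP
  exact ⟨h1, h1.symm.trans (polyAdvice_P_eq_polyAdvice_PH_of_polyAdvice_P_eq_polyAdvice_NP h1)⟩

/-- **pnp.S26 (characteristic zero) from (A3) alone.** Bürgisser's collapse
`P/poly = NP/poly = PH/poly` under `VP_k = VNP_k` (char. 0) and GRH (TCS 235, Cor. 1.2(1), p. 74;
book Cor. 4.6(1)), i.e. the named fact `burgisser_collapse_of_VP_eq_VNP_charZero k` of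
`ValiantBooleanBridge.lean` with BOTH conjuncts, follows from the named fact (A3)
`booleanPart_VP_cktSize k` (TCS Thm. 1.1(1): `BP(VP_k) ⊆ FP/poly` under GRH): (A2)
`#P ⊆ BP(VNP_k)` (`NP_booleanPart_VNP_holds`) gives `NP ⊆ P/poly`
(`NP_subset_PPoly_of_VP_eq_VNP_of_A3`), and `polyAdvice_collapse_of_NP_subset_PPoly` concludes.
[cite: Burgisser2000TCS, Cor. 1.2(1) p. 74 and Thm. 1.1(1) p. 73] [cite: Burgisser2000, Cor. 4.6(1)] -/
theorem burgisser_collapse_of_VP_eq_VNP_charZero_of_booleanPart_VP_cktSize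
    (hA3 : booleanPart_VP_cktSize k) : burgisser_collapse_of_VP_eq_VNP_charZero k := by
  intro _ hGRH h
  exact polyAdvice_collapse_of_NP_subset_PPoly (NP_subset_PPoly_of_VP_eq_VNP_of_A3 hA3 hGRH h)

/-- **pnp.S26 (characteristic zero) from Theorem 4.1 alone**: `burgisser_collapse_of_VP_eq_VNP_charZero k`
follows from the reduction-modulo-primes theorem `reduction_mod_primes_of_GRH` (TCS Thm. 4.1,
p. 79, the only place where GRH enters), (A3) being assembled from it in
`BurgisserBooleanPartsA3Assembly.lean` (`booleanPart_VP_cktSize_of_reduction_mod_primes`).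
[cite: Burgisser2000TCS, Cor. 1.2(1) p. 74 and Thm. 4.1 p. 79] -/
theorem burgisser_collapse_of_VP_eq_VNP_charZero_of_reduction_mod_primes
    (h41 : reduction_mod_primes_of_GRH) : burgisser_collapse_of_VP_eq_VNP_charZero k :=
  burgisser_collapse_of_VP_eq_VNP_charZero_of_booleanPart_VP_cktSize k
    (booleanPart_VP_cktSize_of_reduction_mod_primes k h41)

/-- **pnp.S26 (characteristic zero) from Theorem 4.5 and Corollary 4.8**:
`burgisser_collapse_of_VP_eq_VNP_charZero k` follows from the Krick–Pardo height bound
`algebraicSolution_height_bound` (TCS Thm. 4.5, p. 82) and the GRH count of primes with a root of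
the minimal polynomial `rootModPrimeCount_lower_bound_of_GRH` (TCS Cor. 4.8, p. 84), Thm. 4.1 being
their proved combination (`reduction_mod_primes_of_GRH_of_facts`, `BurgisserReductionModPrimes.lean`).
[cite: Burgisser2000TCS, Cor. 1.2(1) p. 74, Thm. 4.5 p. 82 and Cor. 4.8 p. 84] -/
theorem burgisser_collapse_of_VP_eq_VNP_charZero_of_heightBound_of_rootCount
    (h45 : algebraicSolution_height_bound) (h48 : rootModPrimeCount_lower_bound_of_GRH) :
    burgisser_collapse_of_VP_eq_VNP_charZero k :=
  burgisser_collapse_of_VP_eq_VNP_charZero_of_reduction_mod_primes k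
    (reduction_mod_primes_of_GRH_of_facts h45 h48)

/-- **pnp.S26 (characteristic zero) from the two external theorems.** Bürgisser's collapse
`P/poly = NP/poly = PH/poly` under `VP_k = VNP_k` in characteristic zero and GRH (TCS 235,
Cor. 1.2(1), p. 74; book Thm. 4.5 / Cor. 4.6(1)), i.e. `burgisser_collapse_of_VP_eq_VNP_charZero k`,
follows from `algebraicSolution_height_bound` (TCS Thm. 4.5: algebraic solutions of small height,
after Krick–Pardo) and `effectivePrimeIdealTheorem_of_ERH` (the prime ideal theorem under GRH with
an absolute constant, Lagarias–Odlyzko 1977 Thm. 1.1 / Serre 1981 Thm. 4, which is eq. (3), p. 83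
of the paper), Cor. 4.8 being proved from the latter in `BurgisserRootCountGRH.lean`. Every other
step of the printed proof is proved in the tree; the discharge `burgisser_collapse_of_VP_eq_VNP_charZero_holds`
is this theorem applied to the `_holds` theorems of the two facts.
[cite: Burgisser2000TCS, Cor. 1.2(1) p. 74, Thm. 4.5 p. 82 and eq. (3) p. 83] [cite: Burgisser2000, Thm. 4.5 and Cor. 4.6(1)] -/
theorem burgisser_collapse_of_VP_eq_VNP_charZero_of_heightBound_of_effectivePrimeIdealTheorem
    (h45 : algebraicSolution_height_bound) (hPIT : effectivePrimeIdealTheorem_of_ERH) :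
    burgisser_collapse_of_VP_eq_VNP_charZero k :=
  burgisser_collapse_of_VP_eq_VNP_charZero_of_reduction_mod_primes k
    (reduction_mod_primes_of_GRH_of_heightBound_of_effectivePrimeIdealTheorem h45 hPIT)

/-- The same with the conclusion unfolded: under the two external facts, GRH and `VP_k = VNP_k`
over a field of characteristic zero give `polyAdvice P = polyAdvice NP = polyAdvice PH`
(Bürgisser 2000 TCS, Cor. 1.2(1)). [cite: Burgisser2000TCS, Cor. 1.2(1) p. 74] -/
theorem polyAdvice_collapse_of_VP_eq_VNP_of_heightBound_of_effectivePrimeIdealTheorem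
    (h45 : algebraicSolution_height_bound) (hPIT : effectivePrimeIdealTheorem_of_ERH) [CharZero k]
    (hGRH : Literature.NumberTheory.LFunctions.ExtendedRiemannHypothesis) (h : VP k = VNP k) :
    polyAdvice P = polyAdvice NP ∧ polyAdvice NP = polyAdvice PH :=
  burgisser_collapse_of_VP_eq_VNP_charZero_of_heightBound_of_effectivePrimeIdealTheorem k h45 hPIT
    hGRH h

/-! ### pnp.S26 (char. 0) from Theorem 4.5 alone

Bürgisser 2000 TCS, p. 83, eq. (3): "`|π_K(x) − Li(x)| ≤ c √x log(|d_K| x^n)` provided (GRH)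
holds (Weinberger [28]; Lagarias–Odlyzko [19])" — this is the named fact
`effectivePrimeIdealTheorem_of_ERH`, discharged in the tree on 2026-08-15
(`effectivePrimeIdealTheorem_of_ERH_holds`, `EffectivePrimeIdealTheoremGRHProofs.lean`). Feeding the
discharge into the proved implications of `BurgisserRootCountGRH.lean` (Cor. 4.8 and Thm. 4.1 from
Thm. 4.5 and the effective prime ideal theorem) and of this file removes the GRH-side named fact
from every level of the table in the module docstring. -/

/-- **(A3) from Theorem 4.5 alone** (Bürgisser 2000 TCS, Thm. 1.1(1) p. 73 and §5 (A3) pp. 85–86: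
under GRH, in characteristic zero, a Boolean part of a p-computable family has polynomial-size
Boolean circuits): the named fact `booleanPart_VP_cktSize k` follows from the Krick–Pardo height
bound `algebraicSolution_height_bound` (TCS Thm. 4.5), the effective prime ideal theorem under GRH
(eq. (3) p. 83) being the tree's theorem `effectivePrimeIdealTheorem_of_ERH_holds` and Cor. 4.8,
Thm. 4.1 and (A3) their proved consequences
(`booleanPart_VP_cktSize_of_heightBound_of_effectivePrimeIdealTheorem`, `BurgisserRootCountGRH.lean`).
[cite: Burgisser2000TCS, Thm. 1.1(1) p. 73, §5 (A3) pp. 85–86, Thm. 4.5 p. 82 and eq. (3) p. 83] -/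
theorem booleanPart_VP_cktSize_of_heightBound (h45 : algebraicSolution_height_bound) :
    booleanPart_VP_cktSize k :=
  booleanPart_VP_cktSize_of_heightBound_of_effectivePrimeIdealTheorem k h45
    effectivePrimeIdealTheorem_of_ERH_holds

/-- **`VP_k = VNP_k ⟹ P/poly = NP/poly` (GRH, char. 0) from Theorem 4.5 alone** (Bürgisser 2000
TCS, Cor. 1.2(1), p. 74): the named fact `PPoly_eq_polyAdvice_NP_of_VP_eq_VNP k` of
`ValiantBooleanBridge.lean` follows from `algebraicSolution_height_bound` (TCS Thm. 4.5); every other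
step of the printed proof — (A2), the assembly with Arora–Barak Thm. 6.18, the skeleton and the
Nullstellensatz transfer, Rem. 4.6, eq. (3) p. 83 (the effective prime ideal theorem under GRH,
`effectivePrimeIdealTheorem_of_ERH_holds`), Thm. 4.7/Cor. 4.8, Chebyshev's bound and the Boolean
simulation modulo `p` — is proved in the tree.
[cite: Burgisser2000TCS, Cor. 1.2(1) p. 74, Thm. 4.5 p. 82 and eq. (3) p. 83] -/
theorem PPoly_eq_polyAdvice_NP_of_VP_eq_VNP_of_heightBound (h45 : algebraicSolution_height_bound) :
    PPoly_eq_polyAdvice_NP_of_VP_eq_VNP k :=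
  PPoly_eq_polyAdvice_NP_of_VP_eq_VNP_of_heightBound_of_effectivePrimeIdealTheorem k h45
    effectivePrimeIdealTheorem_of_ERH_holds

/-- **pnp.S26 (characteristic zero) from Theorem 4.5 alone.** Bürgisser's collapse
`P/poly = NP/poly = PH/poly` under `VP_k = VNP_k` in characteristic zero and GRH (TCS 235,
Cor. 1.2(1), p. 74; book Thm. 4.5 / Cor. 4.6(1)), i.e. the named fact
`burgisser_collapse_of_VP_eq_VNP_charZero k` with both conjuncts, follows from the single named fact
`algebraicSolution_height_bound` (TCS Thm. 4.5, p. 82: algebraic solutions of small height, after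
Krick–Pardo [18, Prop. 27] and Bézout's inequality). The GRH input of the printed proof, eq. (3)
p. 83 (the effective prime ideal theorem: Weinberger [28], Lagarias–Odlyzko [19]; Serre 1981,
Thm. 4), is the tree's theorem `effectivePrimeIdealTheorem_of_ERH_holds`; the discharge
`burgisser_collapse_of_VP_eq_VNP_charZero_holds` is this theorem applied to
`algebraicSolution_height_bound_holds` once Thm. 4.5 is proved.
[cite: Burgisser2000TCS, Cor. 1.2(1) p. 74, Thm. 4.5 p. 82 and eq. (3) p. 83] [cite: Burgisser2000, Thm. 4.5 and Cor. 4.6(1)] -/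
theorem burgisser_collapse_of_VP_eq_VNP_charZero_of_heightBound
    (h45 : algebraicSolution_height_bound) : burgisser_collapse_of_VP_eq_VNP_charZero k :=
  burgisser_collapse_of_VP_eq_VNP_charZero_of_heightBound_of_effectivePrimeIdealTheorem k h45
    effectivePrimeIdealTheorem_of_ERH_holds

/-- The same with the conclusion unfolded: under Theorem 4.5, GRH and `VP_k = VNP_k` over a field of
characteristic zero give `polyAdvice P = polyAdvice NP = polyAdvice PH` (Bürgisser 2000 TCS,
Cor. 1.2(1)). [cite: Burgisser2000TCS, Cor. 1.2(1) p. 74] -/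
theorem polyAdvice_collapse_of_VP_eq_VNP_of_heightBound (h45 : algebraicSolution_height_bound)
    [CharZero k] (hGRH : Literature.NumberTheory.LFunctions.ExtendedRiemannHypothesis)
    (h : VP k = VNP k) : polyAdvice P = polyAdvice NP ∧ polyAdvice NP = polyAdvice PH :=
  burgisser_collapse_of_VP_eq_VNP_charZero_of_heightBound k h45 hGRH h

end Literature.Computability.AlgebraicComplexity

end
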